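import Summits.QuantumFields.BalabanUV.Beta.CompositeMixedWardRootedDiv

/-!
# `BalabanUV.Beta.CompositeMixedWardRooted` — row D1 ∕ (C1), PART 110b: THE SYMMETRISED COMPOSITE MIXED WARD LAW BY INDUCTION ON THE DEPTH — «HG FORM»
# (generic bricks): the `f ↔ f′`-symmetrised background divergence of the composite mixed kernel IS twice the composite Hessian built from the Hessian brick
# WEIGHTED BY THE GAUGE JUMP BETWEEN ITS OWN-LEVEL ROOTED LEGS

HONEST DEPENDENCY (page 1, mandatory): continuum YM on T⁴ ⇐ BetaPertH ∧ nine spine estimates (0/9 proved); BetaPertH ⇐ (D1) ∧ (D4) ∧ CAP+tail;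
G-an2-4 gates asym, D1 and NE2/3/4.  HONEST FRAMING (cell contract, verbatim): «discharging `BetaPertH` makes Bałaban's UV stability UNCONDITIONAL —
a real constructive-QFT result; it is NOT the continuum limit and NOT the Clay problem.»  ABSOLUTE RULE (cell charter, verbatim): «No internally-minted
statement may enter as a cited fact. Every hypothesis is either kernel-proved in this package or a verbatim quotation of a PUBLISHED theorem with page
reference. The manuscript(s) under audit are NOT citable for their own disputed steps — they are the thing under adjudication; programme-internal
(2001/route/tribunal) claims are never citable.»

WHY (row-D1 owner an2 gen 86, journal [AN2-G86-W-5], FINDING AN2-86-2).  For ANY bricks `(ℓ, 𝓋, 𝒽, 𝓉)` with the window laws `hℓW`, `h𝓋W` (PART 105a), `h𝓉W`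
(the integrated shape of an2 g21's one-step mixed SITE law `MixedWardSiteLaw.mixKerAt_siteWard`: `2·𝒽(f,f′)·(G(root) − G(f.2))`, NOT symmetric in `f, f′`) and an
ANTISYMMETRIC Hessian brick (`h𝒽a`, an1's `hessKerAt_swap`), **`compMixKer_div_bg_symm`**:
`Σ_κ [(compMixKer m μ y (κ, z − e_κ) f f′ − compMixKer m μ y (κ, z) f f′) + (f ↔ f′)]
   = 2 · compVHKer ℓ 𝒽ᴳ L m μ y f f′`, `𝒽ᴳ k ν w b₁ b₂ := 𝒽 k ν w b₁ b₂ · ([L^k•b₂.2 + R k = z] − [L^k•b₁.2 + R k = z])`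
— the gauge generator at the finest site `z` is read at the Hessian brick's OWN-LEVEL ROOTED LEGS.  Induction over F6's five-summand chain rule `compMixKer_succ`
with PART 110a's five divergences: the finest-leg indicators `[f.2 = z]`, `[f′.2 = z]` and the rooted-leg terms of summands 2∕3 CANCEL IDENTICALLY under `f ↔ f′`
(antisymmetry of `𝒽`, after exchanging the two window bond pairs), summand 4 cancels by the antisymmetry of the composite Hessian (`CompositeHessianTable.compVHKer_swap`),
summand 1 gives the top weighted brick and summand 5 the induction hypothesis — exactly `compVHKer_succ` of the weighted brick.  At depth 1 (`ℓ̂_0 = δ`) this IS the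
j = 0 datum form (an2 g21 `bondWardM`); at depth ≥ 2 it differs from the END's datum (generator at the FINEST legs, `legInd_inl`) by a boundary-layer kernel — the
content of FINDING AN2-86-2 (journal), not asserted in this file.

WHAT: [folklore] finite-sum induction BY NAME over an2's `compLinKer ∕ compVHKer ∕ compMixKer`; no `def` (the weighted brick is an inline lambda fed to the EXISTING
`compVHKer`), no `def … : Prop`, nothing cited, 0 sorry.  Nothing of Bałaban's asserted, valued or discharged; 0 estimates; 0∕4 row-D1 binders; (W)_j NOT claimed;
NOT (C1), NOT D1, NEVER «G-an2-4 closed», NOT BetaPertH, NOT continuum, NOT Clay.  Row D1 ∕ (C1) OWNER «beta-an2», gen 86, 2026-08-30.  No existing file touched.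
-/

noncomputable section

open Finset
open scoped BigOperators
open Literature.MathematicalPhysics.QuantumFieldTheory.Balaban1983to89
open Literature.MathematicalPhysics.QuantumFieldTheory.Balaban1983to89.Beta
open AffineAveraging (Site box toSite unitVec)
open AveragingHessianKernels (Bond Near)
open Summit.QuantumFields.BalabanUV.Beta.CompositeVertexKernelRec
open Summit.QuantumFields.BalabanUV.Beta.CompositeMixedTable (compMixKer compMixKer_zero compMixKer_succ)
open Summit.QuantumFields.BalabanUV.Beta.CompositeHessianTable (compVHKer_swap)
open Summit.QuantumFields.BalabanUV.Beta.CompositeVertexWardRootedTwo (sum_pair_comm)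
open Summit.QuantumFields.BalabanUV.Beta.CompositeMixedWardRootedDiv

namespace Summit.QuantumFields.BalabanUV.Beta.CompositeMixedWardRooted

variable {d : ℕ}

section Generic

variable {ℓ : ℕ → Fin (d + 1) → Site (d + 1) → Bond (d + 1) → ℝ}
  {𝓋 𝒽 : ℕ → Fin (d + 1) → Site (d + 1) → Bond (d + 1) → Bond (d + 1) → ℝ}
  {𝓉 : ℕ → Fin (d + 1) → Site (d + 1) → Bond (d + 1) → Bond (d + 1) → Bond (d + 1) → ℝ} {L : ℕ}
  {ρ : ℕ → Site (d + 1)} {R : ℕ → Site (d + 1)}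
  (hR0 : R 0 = 0) (hRs : ∀ m : ℕ, R (m + 1) = R m + ((L ^ m : ℕ) : ℤ) • ρ m)
  (hℓW : ∀ (k : ℕ) (μ : Fin (d + 1)) (y : Site (d + 1)) (G : Site (d + 1) → ℝ),
    ∑ κ : Fin (d + 1), ∑ e ∈ offs L, ℓ k μ y (κ, (L : ℤ) • y + e) * (G ((L : ℤ) • y + e + unitVec κ) - G ((L : ℤ) • y + e)) =
      G ((L : ℤ) • y + ρ k + (L : ℤ) • unitVec μ) - G ((L : ℤ) • y + ρ k))
  (h𝓋W : ∀ (k : ℕ) (μ : Fin (d + 1)) (y : Site (d + 1)) (f : Bond (d + 1)) (G : Site (d + 1) → ℝ),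
    ∑ κ : Fin (d + 1), ∑ e ∈ offs L, 𝓋 k μ y f (κ, (L : ℤ) • y + e) * (G ((L : ℤ) • y + e + unitVec κ) - G ((L : ℤ) • y + e)) =
      (G ((L : ℤ) • y + ρ k) - G f.2) * ℓ k μ y f)
  (h𝓉W : ∀ (k : ℕ) (μ : Fin (d + 1)) (y : Site (d + 1)) (f f' : Bond (d + 1)) (G : Site (d + 1) → ℝ),
    ∑ κ : Fin (d + 1), ∑ e ∈ offs L, 𝓉 k μ y (κ, (L : ℤ) • y + e) f f' * (G ((L : ℤ) • y + e + unitVec κ) - G ((L : ℤ) • y + e)) =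
      2 * 𝒽 k μ y f f' * (G ((L : ℤ) • y + ρ k) - G f.2))
  (h𝒽a : ∀ (k : ℕ) (μ : Fin (d + 1)) (y : Site (d + 1)) (f f' : Bond (d + 1)), 𝒽 k μ y f' f = -𝒽 k μ y f f')

include hR0 hRs hℓW h𝓋W h𝓉W h𝒽a in
/-- [folklore] **THE SYMMETRISED COMPOSITE MIXED WARD LAW, HG FORM (kernel level, every depth)**: contracted with a fine pure gauge at the site `z` in its BACKGROUND slot
and symmetrised in its two fluctuation slots, the top-peeled composite mixed kernel is twice the composite Hessian over the Hessian brick weighted by the gauge jump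
between its own-level rooted legs:
`Σ_κ [(compMixKer m μ y (κ, z − e_κ) f f′ − compMixKer m μ y (κ, z) f f′) + (f ↔ f′)] = 2 · compVHKer ℓ 𝒽ᴳ L m μ y f f′`,
`𝒽ᴳ k ν w b₁ b₂ = 𝒽 k ν w b₁ b₂ · ([L^k•b₂.2 + R k = z] − [L^k•b₁.2 + R k = z])`. -/
theorem compMixKer_div_bg_symm (z : Site (d + 1)) : ∀ (m : ℕ) (μ : Fin (d + 1)) (y : Site (d + 1)) (f f' : Bond (d + 1)),
    ∑ κ₀ : Fin (d + 1), ((compMixKer ℓ 𝓋 𝒽 𝓉 L m μ y (κ₀, z - unitVec κ₀) f f' - compMixKer ℓ 𝓋 𝒽 𝓉 L m μ y (κ₀, z) f f') +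
        (compMixKer ℓ 𝓋 𝒽 𝓉 L m μ y (κ₀, z - unitVec κ₀) f' f - compMixKer ℓ 𝓋 𝒽 𝓉 L m μ y (κ₀, z) f' f)) =
      2 * compVHKer ℓ (fun k ν w b₁ b₂ => 𝒽 k ν w b₁ b₂ *
          ((if ((L ^ k : ℕ) : ℤ) • b₂.2 + R k = z then (1 : ℝ) else 0) - (if ((L ^ k : ℕ) : ℤ) • b₁.2 + R k = z then (1 : ℝ) else 0))) L m μ y f f'
  | 0, μ, y, f, f' => by
    simp only [compMixKer_zero, compVHKer_zero, sub_self, add_zero, Finset.sum_const_zero, mul_zero]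
  | m + 1, μ, y, f, f' => by
    have hIH := compMixKer_div_bg_symm z m
    -- summand 1, both orders: the top mixed brick, read through `h𝓉W`; the two orders combine (pair exchange + antisymmetry) into the WEIGHTED top brick
    have hA : (∑ κ₁ : Fin (d + 1), ∑ e₁ ∈ offs L, ∑ κ₂ : Fin (d + 1), ∑ e₂ ∈ offs L,
          compLinKer ℓ L m f (κ₁, (L : ℤ) • y + e₁) * compLinKer ℓ L m f' (κ₂, (L : ℤ) • y + e₂) *
            (2 * 𝒽 m μ y (κ₁, (L : ℤ) • y + e₁) (κ₂, (L : ℤ) • y + e₂) *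
              ((if ((L ^ m : ℕ) : ℤ) • ((L : ℤ) • y + ρ m) + R m = z then (1 : ℝ) else 0) -
                (if ((L ^ m : ℕ) : ℤ) • ((L : ℤ) • y + e₁) + R m = z then (1 : ℝ) else 0)))) +
        (∑ κ₁ : Fin (d + 1), ∑ e₁ ∈ offs L, ∑ κ₂ : Fin (d + 1), ∑ e₂ ∈ offs L,
          compLinKer ℓ L m f' (κ₁, (L : ℤ) • y + e₁) * compLinKer ℓ L m f (κ₂, (L : ℤ) • y + e₂) *
            (2 * 𝒽 m μ y (κ₁, (L : ℤ) • y + e₁) (κ₂, (L : ℤ) • y + e₂) *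
              ((if ((L ^ m : ℕ) : ℤ) • ((L : ℤ) • y + ρ m) + R m = z then (1 : ℝ) else 0) -
                (if ((L ^ m : ℕ) : ℤ) • ((L : ℤ) • y + e₁) + R m = z then (1 : ℝ) else 0)))) =
        2 * ∑ κ₁ : Fin (d + 1), ∑ e₁ ∈ offs L, ∑ κ₂ : Fin (d + 1), ∑ e₂ ∈ offs L,
          𝒽 m μ y (κ₁, (L : ℤ) • y + e₁) (κ₂, (L : ℤ) • y + e₂) *
            ((if ((L ^ m : ℕ) : ℤ) • ((L : ℤ) • y + e₂) + R m = z then (1 : ℝ) else 0) -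
              (if ((L ^ m : ℕ) : ℤ) • ((L : ℤ) • y + e₁) + R m = z then (1 : ℝ) else 0)) *
            compLinKer ℓ L m f (κ₁, (L : ℤ) • y + e₁) * compLinKer ℓ L m f' (κ₂, (L : ℤ) • y + e₂) := by
      rw [sum_pair_comm L (fun κ₁ e₁ κ₂ e₂ => compLinKer ℓ L m f' (κ₁, (L : ℤ) • y + e₁) * compLinKer ℓ L m f (κ₂, (L : ℤ) • y + e₂) *
            (2 * 𝒽 m μ y (κ₁, (L : ℤ) • y + e₁) (κ₂, (L : ℤ) • y + e₂) *
              ((if ((L ^ m : ℕ) : ℤ) • ((L : ℤ) • y + ρ m) + R m = z then (1 : ℝ) else 0) -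
                (if ((L ^ m : ℕ) : ℤ) • ((L : ℤ) • y + e₁) + R m = z then (1 : ℝ) else 0))))]
      rw [Finset.mul_sum, ← Finset.sum_add_distrib]
      refine Finset.sum_congr rfl fun κ₁ _ => ?_
      rw [Finset.mul_sum, ← Finset.sum_add_distrib]
      refine Finset.sum_congr rfl fun e₁ _ => ?_
      rw [Finset.mul_sum, ← Finset.sum_add_distrib]
      refine Finset.sum_congr rfl fun κ₂ _ => ?_
      rw [Finset.mul_sum, ← Finset.sum_add_distrib]
      refine Finset.sum_congr rfl fun e₂ _ => ?_
      rw [h𝒽a m μ y (κ₁, (L : ℤ) • y + e₁) (κ₂, (L : ℤ) • y + e₂)]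
      ring
    -- summands 2 + 3, both orders: the finest-leg indicators and the rooted-leg terms CANCEL IDENTICALLY
    have hB : (∑ κ₁ : Fin (d + 1), ∑ e₁ ∈ offs L, ∑ κ₂ : Fin (d + 1), ∑ e₂ ∈ offs L,
          compLinKer ℓ L m f (κ₁, (L : ℤ) • y + e₁) * compLinKer ℓ L m f' (κ₂, (L : ℤ) • y + e₂) *
            (((if ((L ^ m : ℕ) : ℤ) • ((L : ℤ) • y + e₁) + R m = z then (1 : ℝ) else 0) - (if f.2 = z then (1 : ℝ) else 0)) *
              𝒽 m μ y (κ₁, (L : ℤ) • y + e₁) (κ₂, (L : ℤ) • y + e₂))) +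
        (∑ κ₁ : Fin (d + 1), ∑ e₁ ∈ offs L, ∑ κ₂ : Fin (d + 1), ∑ e₂ ∈ offs L,
          compLinKer ℓ L m f (κ₁, (L : ℤ) • y + e₁) * compLinKer ℓ L m f' (κ₂, (L : ℤ) • y + e₂) *
            (((if ((L ^ m : ℕ) : ℤ) • ((L : ℤ) • y + e₂) + R m = z then (1 : ℝ) else 0) - (if f'.2 = z then (1 : ℝ) else 0)) *
              𝒽 m μ y (κ₁, (L : ℤ) • y + e₁) (κ₂, (L : ℤ) • y + e₂))) +
        ((∑ κ₁ : Fin (d + 1), ∑ e₁ ∈ offs L, ∑ κ₂ : Fin (d + 1), ∑ e₂ ∈ offs L,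
          compLinKer ℓ L m f' (κ₁, (L : ℤ) • y + e₁) * compLinKer ℓ L m f (κ₂, (L : ℤ) • y + e₂) *
            (((if ((L ^ m : ℕ) : ℤ) • ((L : ℤ) • y + e₁) + R m = z then (1 : ℝ) else 0) - (if f'.2 = z then (1 : ℝ) else 0)) *
              𝒽 m μ y (κ₁, (L : ℤ) • y + e₁) (κ₂, (L : ℤ) • y + e₂))) +
        (∑ κ₁ : Fin (d + 1), ∑ e₁ ∈ offs L, ∑ κ₂ : Fin (d + 1), ∑ e₂ ∈ offs L,
          compLinKer ℓ L m f' (κ₁, (L : ℤ) • y + e₁) * compLinKer ℓ L m f (κ₂, (L : ℤ) • y + e₂) *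
            (((if ((L ^ m : ℕ) : ℤ) • ((L : ℤ) • y + e₂) + R m = z then (1 : ℝ) else 0) - (if f.2 = z then (1 : ℝ) else 0)) *
              𝒽 m μ y (κ₁, (L : ℤ) • y + e₁) (κ₂, (L : ℤ) • y + e₂)))) = 0 := by
      rw [sum_pair_comm L (fun κ₁ e₁ κ₂ e₂ => compLinKer ℓ L m f' (κ₁, (L : ℤ) • y + e₁) * compLinKer ℓ L m f (κ₂, (L : ℤ) • y + e₂) *
            (((if ((L ^ m : ℕ) : ℤ) • ((L : ℤ) • y + e₁) + R m = z then (1 : ℝ) else 0) - (if f'.2 = z then (1 : ℝ) else 0)) *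
              𝒽 m μ y (κ₁, (L : ℤ) • y + e₁) (κ₂, (L : ℤ) • y + e₂))),
        sum_pair_comm L (fun κ₁ e₁ κ₂ e₂ => compLinKer ℓ L m f' (κ₁, (L : ℤ) • y + e₁) * compLinKer ℓ L m f (κ₂, (L : ℤ) • y + e₂) *
            (((if ((L ^ m : ℕ) : ℤ) • ((L : ℤ) • y + e₂) + R m = z then (1 : ℝ) else 0) - (if f.2 = z then (1 : ℝ) else 0)) *
              𝒽 m μ y (κ₁, (L : ℤ) • y + e₁) (κ₂, (L : ℤ) • y + e₂)))]
      simp only [← Finset.sum_add_distrib]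
      refine Finset.sum_eq_zero fun κ₁ _ => Finset.sum_eq_zero fun e₁ _ => Finset.sum_eq_zero fun κ₂ _ => Finset.sum_eq_zero fun e₂ _ => ?_
      rw [h𝒽a m μ y (κ₁, (L : ℤ) • y + e₁) (κ₂, (L : ℤ) • y + e₂)]
      ring
    -- summand 4, both orders: cancels by the antisymmetry of the composite Hessian
    have hC : (∑ κ₁ : Fin (d + 1), ∑ e₁ ∈ offs L, compVHKer ℓ 𝒽 L m κ₁ ((L : ℤ) • y + e₁) f f' *
          (((if ((L ^ m : ℕ) : ℤ) • ((L : ℤ) • y + ρ m) + R m = z then (1 : ℝ) else 0) -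
              (if ((L ^ m : ℕ) : ℤ) • ((L : ℤ) • y + e₁) + R m = z then (1 : ℝ) else 0)) * ℓ m μ y (κ₁, (L : ℤ) • y + e₁))) +
        (∑ κ₁ : Fin (d + 1), ∑ e₁ ∈ offs L, compVHKer ℓ 𝒽 L m κ₁ ((L : ℤ) • y + e₁) f' f *
          (((if ((L ^ m : ℕ) : ℤ) • ((L : ℤ) • y + ρ m) + R m = z then (1 : ℝ) else 0) -
              (if ((L ^ m : ℕ) : ℤ) • ((L : ℤ) • y + e₁) + R m = z then (1 : ℝ) else 0)) * ℓ m μ y (κ₁, (L : ℤ) • y + e₁))) = 0 := by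
      simp only [← Finset.sum_add_distrib]
      refine Finset.sum_eq_zero fun κ₁ _ => Finset.sum_eq_zero fun e₁ _ => ?_
      rw [compVHKer_swap h𝒽a m κ₁ ((L : ℤ) • y + e₁) f f']
      ring
    -- summand 5, both orders: the induction hypothesis under the top linear brick
    have hD : (∑ κ : Fin (d + 1), ∑ e ∈ offs L, ℓ m μ y (κ, (L : ℤ) • y + e) *
          ∑ κ₀ : Fin (d + 1), (compMixKer ℓ 𝓋 𝒽 𝓉 L m κ ((L : ℤ) • y + e) (κ₀, z - unitVec κ₀) f f' -
            compMixKer ℓ 𝓋 𝒽 𝓉 L m κ ((L : ℤ) • y + e) (κ₀, z) f f')) +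
        (∑ κ : Fin (d + 1), ∑ e ∈ offs L, ℓ m μ y (κ, (L : ℤ) • y + e) *
          ∑ κ₀ : Fin (d + 1), (compMixKer ℓ 𝓋 𝒽 𝓉 L m κ ((L : ℤ) • y + e) (κ₀, z - unitVec κ₀) f' f -
            compMixKer ℓ 𝓋 𝒽 𝓉 L m κ ((L : ℤ) • y + e) (κ₀, z) f' f)) =
        2 * ∑ κ : Fin (d + 1), ∑ e ∈ offs L, ℓ m μ y (κ, (L : ℤ) • y + e) *
          compVHKer ℓ (fun k ν w b₁ b₂ => 𝒽 k ν w b₁ b₂ *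
            ((if ((L ^ k : ℕ) : ℤ) • b₂.2 + R k = z then (1 : ℝ) else 0) - (if ((L ^ k : ℕ) : ℤ) • b₁.2 + R k = z then (1 : ℝ) else 0)))
            L m κ ((L : ℤ) • y + e) f f' := by
      rw [Finset.mul_sum, ← Finset.sum_add_distrib]
      refine Finset.sum_congr rfl fun κ _ => ?_
      rw [Finset.mul_sum, ← Finset.sum_add_distrib]
      refine Finset.sum_congr rfl fun e _ => ?_
      rw [← mul_add, ← Finset.sum_add_distrib, hIH κ ((L : ℤ) • y + e) f f']
      ring
    -- assemble
    calc ∑ κ₀ : Fin (d + 1), ((compMixKer ℓ 𝓋 𝒽 𝓉 L (m + 1) μ y (κ₀, z - unitVec κ₀) f f' - compMixKer ℓ 𝓋 𝒽 𝓉 L (m + 1) μ y (κ₀, z) f f') +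
          (compMixKer ℓ 𝓋 𝒽 𝓉 L (m + 1) μ y (κ₀, z - unitVec κ₀) f' f - compMixKer ℓ 𝓋 𝒽 𝓉 L (m + 1) μ y (κ₀, z) f' f))
        = ((∑ κ₁ : Fin (d + 1), ∑ e₁ ∈ offs L, ∑ κ₂ : Fin (d + 1), ∑ e₂ ∈ offs L,
              compLinKer ℓ L m f (κ₁, (L : ℤ) • y + e₁) * compLinKer ℓ L m f' (κ₂, (L : ℤ) • y + e₂) *
                (2 * 𝒽 m μ y (κ₁, (L : ℤ) • y + e₁) (κ₂, (L : ℤ) • y + e₂) *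
                  ((if ((L ^ m : ℕ) : ℤ) • ((L : ℤ) • y + ρ m) + R m = z then (1 : ℝ) else 0) -
                    (if ((L ^ m : ℕ) : ℤ) • ((L : ℤ) • y + e₁) + R m = z then (1 : ℝ) else 0)))) +
            (∑ κ₁ : Fin (d + 1), ∑ e₁ ∈ offs L, ∑ κ₂ : Fin (d + 1), ∑ e₂ ∈ offs L,
              compLinKer ℓ L m f (κ₁, (L : ℤ) • y + e₁) * compLinKer ℓ L m f' (κ₂, (L : ℤ) • y + e₂) *
                (((if ((L ^ m : ℕ) : ℤ) • ((L : ℤ) • y + e₁) + R m = z then (1 : ℝ) else 0) - (if f.2 = z then (1 : ℝ) else 0)) *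
                  𝒽 m μ y (κ₁, (L : ℤ) • y + e₁) (κ₂, (L : ℤ) • y + e₂))) +
            (∑ κ₁ : Fin (d + 1), ∑ e₁ ∈ offs L, ∑ κ₂ : Fin (d + 1), ∑ e₂ ∈ offs L,
              compLinKer ℓ L m f (κ₁, (L : ℤ) • y + e₁) * compLinKer ℓ L m f' (κ₂, (L : ℤ) • y + e₂) *
                (((if ((L ^ m : ℕ) : ℤ) • ((L : ℤ) • y + e₂) + R m = z then (1 : ℝ) else 0) - (if f'.2 = z then (1 : ℝ) else 0)) *
                  𝒽 m μ y (κ₁, (L : ℤ) • y + e₁) (κ₂, (L : ℤ) • y + e₂))) +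
            (∑ κ₁ : Fin (d + 1), ∑ e₁ ∈ offs L, compVHKer ℓ 𝒽 L m κ₁ ((L : ℤ) • y + e₁) f f' *
              (((if ((L ^ m : ℕ) : ℤ) • ((L : ℤ) • y + ρ m) + R m = z then (1 : ℝ) else 0) -
                  (if ((L ^ m : ℕ) : ℤ) • ((L : ℤ) • y + e₁) + R m = z then (1 : ℝ) else 0)) * ℓ m μ y (κ₁, (L : ℤ) • y + e₁))) +
            (∑ κ : Fin (d + 1), ∑ e ∈ offs L, ℓ m μ y (κ, (L : ℤ) • y + e) *
              ∑ κ₀ : Fin (d + 1), (compMixKer ℓ 𝓋 𝒽 𝓉 L m κ ((L : ℤ) • y + e) (κ₀, z - unitVec κ₀) f f' -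
                compMixKer ℓ 𝓋 𝒽 𝓉 L m κ ((L : ℤ) • y + e) (κ₀, z) f f'))) +
          ((∑ κ₁ : Fin (d + 1), ∑ e₁ ∈ offs L, ∑ κ₂ : Fin (d + 1), ∑ e₂ ∈ offs L,
              compLinKer ℓ L m f' (κ₁, (L : ℤ) • y + e₁) * compLinKer ℓ L m f (κ₂, (L : ℤ) • y + e₂) *
                (2 * 𝒽 m μ y (κ₁, (L : ℤ) • y + e₁) (κ₂, (L : ℤ) • y + e₂) *
                  ((if ((L ^ m : ℕ) : ℤ) • ((L : ℤ) • y + ρ m) + R m = z then (1 : ℝ) else 0) -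
                    (if ((L ^ m : ℕ) : ℤ) • ((L : ℤ) • y + e₁) + R m = z then (1 : ℝ) else 0)))) +
            (∑ κ₁ : Fin (d + 1), ∑ e₁ ∈ offs L, ∑ κ₂ : Fin (d + 1), ∑ e₂ ∈ offs L,
              compLinKer ℓ L m f' (κ₁, (L : ℤ) • y + e₁) * compLinKer ℓ L m f (κ₂, (L : ℤ) • y + e₂) *
                (((if ((L ^ m : ℕ) : ℤ) • ((L : ℤ) • y + e₁) + R m = z then (1 : ℝ) else 0) - (if f'.2 = z then (1 : ℝ) else 0)) *
                  𝒽 m μ y (κ₁, (L : ℤ) • y + e₁) (κ₂, (L : ℤ) • y + e₂))) +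
            (∑ κ₁ : Fin (d + 1), ∑ e₁ ∈ offs L, ∑ κ₂ : Fin (d + 1), ∑ e₂ ∈ offs L,
              compLinKer ℓ L m f' (κ₁, (L : ℤ) • y + e₁) * compLinKer ℓ L m f (κ₂, (L : ℤ) • y + e₂) *
                (((if ((L ^ m : ℕ) : ℤ) • ((L : ℤ) • y + e₂) + R m = z then (1 : ℝ) else 0) - (if f.2 = z then (1 : ℝ) else 0)) *
                  𝒽 m μ y (κ₁, (L : ℤ) • y + e₁) (κ₂, (L : ℤ) • y + e₂))) +
            (∑ κ₁ : Fin (d + 1), ∑ e₁ ∈ offs L, compVHKer ℓ 𝒽 L m κ₁ ((L : ℤ) • y + e₁) f' f *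
              (((if ((L ^ m : ℕ) : ℤ) • ((L : ℤ) • y + ρ m) + R m = z then (1 : ℝ) else 0) -
                  (if ((L ^ m : ℕ) : ℤ) • ((L : ℤ) • y + e₁) + R m = z then (1 : ℝ) else 0)) * ℓ m μ y (κ₁, (L : ℤ) • y + e₁))) +
            (∑ κ : Fin (d + 1), ∑ e ∈ offs L, ℓ m μ y (κ, (L : ℤ) • y + e) *
              ∑ κ₀ : Fin (d + 1), (compMixKer ℓ 𝓋 𝒽 𝓉 L m κ ((L : ℤ) • y + e) (κ₀, z - unitVec κ₀) f' f -
                compMixKer ℓ 𝓋 𝒽 𝓉 L m κ ((L : ℤ) • y + e) (κ₀, z) f' f))) := by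
          rw [← div_mixTop hR0 hRs hℓW h𝓉W m μ y f f' z, ← div_mixTop hR0 hRs hℓW h𝓉W m μ y f' f z,
            ← div_hessLeft hR0 hRs hℓW h𝓋W m μ y f f' z, ← div_hessLeft hR0 hRs hℓW h𝓋W m μ y f' f z,
            ← div_hessRight hR0 hRs hℓW h𝓋W m μ y f f' z, ← div_hessRight hR0 hRs hℓW h𝓋W m μ y f' f z,
            ← div_vertHess hR0 hRs hℓW h𝓋W (𝒽 := 𝒽) m μ y f f' z, ← div_vertHess hR0 hRs hℓW h𝓋W (𝒽 := 𝒽) m μ y f' f z,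
            ← div_linMixed (ℓ := ℓ) (𝓋 := 𝓋) (𝒽 := 𝒽) (𝓉 := 𝓉) (L := L) m μ y f f' z,
            ← div_linMixed (ℓ := ℓ) (𝓋 := 𝓋) (𝒽 := 𝒽) (𝓉 := 𝓉) (L := L) m μ y f' f z]
          simp only [← Finset.sum_add_distrib]
          refine Finset.sum_congr rfl fun κ₀ _ => ?_
          rw [compMixKer_succ, compMixKer_succ, compMixKer_succ, compMixKer_succ]
          ring
      _ = 2 * (∑ κ₁ : Fin (d + 1), ∑ e₁ ∈ offs L, ∑ κ₂ : Fin (d + 1), ∑ e₂ ∈ offs L,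
              𝒽 m μ y (κ₁, (L : ℤ) • y + e₁) (κ₂, (L : ℤ) • y + e₂) *
                ((if ((L ^ m : ℕ) : ℤ) • ((L : ℤ) • y + e₂) + R m = z then (1 : ℝ) else 0) -
                  (if ((L ^ m : ℕ) : ℤ) • ((L : ℤ) • y + e₁) + R m = z then (1 : ℝ) else 0)) *
                compLinKer ℓ L m f (κ₁, (L : ℤ) • y + e₁) * compLinKer ℓ L m f' (κ₂, (L : ℤ) • y + e₂)) +
          2 * ∑ κ : Fin (d + 1), ∑ e ∈ offs L, ℓ m μ y (κ, (L : ℤ) • y + e) *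
            compVHKer ℓ (fun k ν w b₁ b₂ => 𝒽 k ν w b₁ b₂ *
              ((if ((L ^ k : ℕ) : ℤ) • b₂.2 + R k = z then (1 : ℝ) else 0) - (if ((L ^ k : ℕ) : ℤ) • b₁.2 + R k = z then (1 : ℝ) else 0)))
              L m κ ((L : ℤ) • y + e) f f' := by
          linear_combination hA + hB + hC + hD
      _ = _ := by
          rw [compVHKer_succ, mul_add]

end Generic

end Summit.QuantumFields.BalabanUV.Beta.CompositeMixedWardRooted

end
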